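import Summits.NavierStokesRegularity.FluidComputer.ImplicitMajorantRow
import HarnessLib

/-!
# A-priori closure with an auxiliary (frame-free) state: the inverse-free frame formulation
# (layer T of the ramp enclosure; `pub-fluidc-bp3/R1-DESIGN.md` §6 G5 (K2), G10)

HONEST FRAMING (cell `pub-fluidc`, blueprint seat bp3, gen 17): low prior, high value-of-information
experiment on Tao's machine paradigm; NOT a claim that NS blows up. Pure real analysis, continuing
`ImplicitMajorantRow.lean`.

WHY. In the kernel the frame coordinates are `z := A(t) e` with `A` a TABULATED piecewise-linear
matrix (so `z` is defined without any inverse), and the deviation `e` is recovered through a tabulated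
approximate inverse `T̂`: `e = T̂ z + R e` with the residual matrix `R := I − T̂A`, whose entries are
tiny and tabulated-bounded (`|R| ≤ Rm`). Then
`ż = (ȦT̂ + ṡAPJT̂) z + (ȦR + ṡAPJR) e + ṡAP(Q(e) + δF)`: the coefficient `K := ȦT̂ + ṡAPJT̂` is a
matrix POLYNOMIAL in `t` on the piece (clean entrywise sup bounds, hypothesis `hK` of `step`), and the
rest is forcing, bounded by a table `φ = φ(W̄, Ē)` AS LONG AS `|z| ≤ W̄` and `|e| ≤ Ē`. No matrix
inverse, no Neumann series and no operator norm ever enters the Lean side. This file closes the two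
a-priori bounds simultaneously by continuity: `rowClosureAux`.

STATEMENT (`rowClosureAux`). Data of `rowInterior` on `[T₀, T₁]`, an auxiliary continuous family
`e : ℝ → κ → ℝ` with the pointwise relation `|e a| ≤ Σᵢ G a i |zᵢ| + Σ_b Rm a b |e b|` (`G = |T̂|`,
`Rm ≥ |R|`, both ≥ 0), the forcing bound assumed only while BOTH `|z| ≤ W̄` and `|e| ≤ Ē` have held,
the strict rows `A S u + b S < W̄` and `G W̄ + Rm Ē < Ē` (two `decide` checks), `|z(T₀)| ≤ u`,
`|e(T₀)| ≤ Ē`. Conclusion: on the whole row `|z(s)| ≤ A S u + b S` and `|e(s)| ≤ Ē` — so the forcing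
bound holds unconditionally and `macroRow` applies; the next row starts from
`|e(T₁)| ≤ G u' + Rm Ē` (`aux_start`).

[cite: Tao2016AveragedNS, §5.5 Thm 5.3 (5.5)]
-/

noncomputable section

open Set Real Filter Topology

namespace Summit.NavierStokesRegularity.FluidComputer

namespace ImplicitMajorant

open Literature.Analysis.ODE

variable {ι : Type*} [Fintype ι] [DecidableEq ι] {κ : Type*} [Fintype κ]

omit [DecidableEq ι] in
/-- Start-of-row bookkeeping for the auxiliary bound: from `|e| ≤ G|z| + Rm|e|` pointwise, `|z| ≤ u`
and an OLD bound `|e| ≤ Ē₀`, the new bound `|e a| ≤ Σ G a i uᵢ + Σ Rm a b Ē₀ b`. [folklore] -/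
theorem aux_start {zv : ι → ℝ} {ev : κ → ℝ} {G : κ → ι → ℝ} {Rm : κ → κ → ℝ} {u : ι → ℝ}
    {E0 : κ → ℝ} (hG0 : ∀ a i, 0 ≤ G a i) (hR0 : ∀ a b', 0 ≤ Rm a b')
    (hrel : ∀ a, |ev a| ≤ ∑ i, G a i * |zv i| + ∑ b', Rm a b' * |ev b'|)
    (hu : ∀ i, |zv i| ≤ u i) (he : ∀ a, |ev a| ≤ E0 a) :
    ∀ a, |ev a| ≤ ∑ i, G a i * u i + ∑ b', Rm a b' * E0 b' := by
  intro a
  refine (hrel a).trans (add_le_add ?_ ?_)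
  · exact Finset.sum_le_sum fun i _ => mul_le_mul_of_nonneg_left (hu i) (hG0 a i)
  · exact Finset.sum_le_sum fun b' _ => mul_le_mul_of_nonneg_left (he b') (hR0 a b')

/-- **A-priori closure with an auxiliary state** (see the module docstring). [folklore] -/
theorem rowClosureAux {z : ℝ → ι → ℝ} {K : ℝ → ι → ι → ℝ} {f : ℝ → ι → ℝ}
    {B E : ι → ι → ℝ} {φ u : ι → ℝ} {T₀ T₁ h c η' : ℝ} (S : ℕ)
    (A : ℕ → ι → ι → ℝ) (b : ℕ → ι → ℝ) (Wbar : ι → ℝ)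
    {e : ℝ → κ → ℝ} (G : κ → ι → ℝ) (Rm : κ → κ → ℝ) (Ebar : κ → ℝ)
    (hh : 0 < h) (hc : 0 ≤ c) (hT₁ : T₀ ≤ T₁) (hT₁' : T₁ ≤ T₀ + 2 ^ S * h)
    (hzc : ∀ i, ContinuousOn (fun s => z s i) (Icc T₀ T₁))
    (hz : ∀ s ∈ Ico T₀ T₁, ∀ i,
      HasDerivWithinAt (fun r => z r i) (∑ j, K s i j * z s j + f s i) (Ici s) s)
    (hK : ∀ s ∈ Ico T₀ T₁, ∀ i j, |K s i j + (if i = j then c else 0)| ≤ B i j)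
    (hec : ∀ a, ContinuousOn (fun s => e s a) (Icc T₀ T₁))
    (herel : ∀ s ∈ Icc T₀ T₁, ∀ a, |e s a| ≤ ∑ i, G a i * |z s i| + ∑ b', Rm a b' * |e s b'|)
    (hG0 : ∀ a i, 0 ≤ G a i) (hR0 : ∀ a b', 0 ≤ Rm a b')
    (hf : ∀ s ∈ Ico T₀ T₁,
      (∀ r ∈ Icc T₀ s, (∀ i, |z r i| ≤ Wbar i) ∧ (∀ a, |e r a| ≤ Ebar a)) → ∀ i, |f s i| ≤ φ i)
    (hB0 : ∀ i j, 0 ≤ B i j) (hφ0 : ∀ i, 0 ≤ φ i)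
    (hE0 : ∀ i k, 0 ≤ E i k)
    (hE : ∀ w : ι → ℝ, (∀ k, 0 ≤ w k) →
      ∀ i, w i + h * ∑ j, B i j * (∑ k, E j k * w k) ≤ ∑ k, E i k * w k)
    (hη' : exp (c * h) ≤ η')
    (hA0 : ∀ i k, E i k ≤ A 0 i k)
    (hb0 : ∀ i, ∑ k, E i k * (h * (η' * φ k)) ≤ b 0 i)
    (hAsq : ∀ n < S, ∀ i k, ∑ j, A n i j * A n j k ≤ A (n + 1) i k)
    (hbsq : ∀ n < S, ∀ i, ∑ j, A n i j * b n j + b n i ≤ b (n + 1) i)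
    (hAI : ∀ n ≤ S, ∀ i k, (if i = k then (1:ℝ) else 0) ≤ A n i k)
    (hbn : ∀ n ≤ S, ∀ i, 0 ≤ b n i)
    (hW : ∀ i, ∑ k, A S i k * u k + b S i < Wbar i)
    (hEbar : ∀ a, ∑ i, G a i * Wbar i + ∑ b', Rm a b' * Ebar b' < Ebar a)
    (hu : ∀ i, |z T₀ i| ≤ u i) (he0 : ∀ a, |e T₀ a| ≤ Ebar a) :
    (∀ s ∈ Icc T₀ T₁, ∀ i, |z s i| ≤ ∑ k, A S i k * u k + b S i) ∧
      (∀ s ∈ Icc T₀ T₁, ∀ a, |e s a| ≤ Ebar a) := by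
  classical
  have hu0 : ∀ k, 0 ≤ u k := fun k => (abs_nonneg _).trans (hu k)
  have hinflS : ∀ i, u i ≤ ∑ k, A S i k * u k + b S i := by
    intro i
    have h1 : ∑ k, (if i = k then (1:ℝ) else 0) * u k ≤ ∑ k, A S i k * u k :=
      Finset.sum_le_sum fun k _ => mul_le_mul_of_nonneg_right (hAI S le_rfl i k) (hu0 k)
    have h2 : ∑ k, (if i = k then (1:ℝ) else 0) * u k = u i := by
      simp [ite_mul, Finset.sum_ite_eq, Finset.mem_univ]
    linarith [hbn S le_rfl i]
  let P : ℝ → Prop := fun t => (∀ i, |z t i| ≤ Wbar i) ∧ (∀ a, |e t a| ≤ Ebar a)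
  have hPa : P T₀ := ⟨fun i => ((hu i).trans (hinflS i)).trans (hW i).le, he0⟩
  have hclosed : ∀ t ∈ Ioc T₀ T₁, (∀ s ∈ Ico T₀ t, P s) → P t := by
    intro t ht hP
    exact ⟨fun i => le_const_of_forall_Ico ((hzc i).abs) ht fun s hs => (hP s hs).1 i,
      fun a => le_const_of_forall_Ico ((hec a).abs) ht fun s hs => (hP s hs).2 a⟩
  set T := maximalTimeP P T₀ T₁ with hT_def
  have hTmem : T ∈ Icc T₀ T₁ := maximalTimeP_mem hT₁ hPa
  have hPT : ∀ t ∈ Icc T₀ T, P t := fun t ht => maximalTimeP_spec hT₁ hPa hclosed ht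
  have hsubc : Icc T₀ T ⊆ Icc T₀ T₁ := Icc_subset_Icc_right hTmem.2
  have hsubo : Ico T₀ T ⊆ Ico T₀ T₁ := Ico_subset_Ico_right hTmem.2
  have hfT : ∀ s ∈ Ico T₀ T, ∀ i, |f s i| ≤ φ i := fun s hs =>
    hf s (hsubo hs) fun r hr => hPT r ⟨hr.1, hr.2.trans hs.2.le⟩
  have hrow := rowInterior S A b hh hc hTmem.1 (hTmem.2.trans hT₁') (fun i => (hzc i).mono hsubc)
    (fun s hs i => hz s (hsubo hs) i) (fun s hs i j => hK s (hsubo hs) i j) hfT hB0 hφ0 hE0 hE hη'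
    hA0 hb0 hAsq hbsq hAI hbn hu
  -- the auxiliary bound is strict at T
  have heT : ∀ a, |e T a| < Ebar a := by
    intro a
    have hPTT := hPT T ⟨hTmem.1, le_rfl⟩
    have h1 := herel T hTmem a
    have h2 : ∑ i, G a i * |z T i| ≤ ∑ i, G a i * Wbar i :=
      Finset.sum_le_sum fun i _ => mul_le_mul_of_nonneg_left (hPTT.1 i) (hG0 a i)
    have h3 : ∑ b', Rm a b' * |e T b'| ≤ ∑ b', Rm a b' * Ebar b' :=
      Finset.sum_le_sum fun b' _ => mul_le_mul_of_nonneg_left (hPTT.2 b') (hR0 a b')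
    linarith [hEbar a]
  have hT : T = T₁ := by
    rcases maximalTimeP_exit hT₁ hPa with h1 | h1
    · exact h1
    · exfalso
      apply h1
      have hz' : ∀ i, ∀ᶠ t in 𝓝[Icc T₀ T₁] T, |z t i| ≤ Wbar i := by
        intro i
        have hlt : |z T i| < Wbar i := (hrow T ⟨hTmem.1, le_rfl⟩ i).trans_lt (hW i)
        have hcw : ContinuousWithinAt (fun s => |z s i|) (Icc T₀ T₁) T := ((hzc i).abs) T hTmem
        exact (hcw.eventually_lt_const hlt).mono fun _ h => h.le
      have he' : ∀ a, ∀ᶠ t in 𝓝[Icc T₀ T₁] T, |e t a| ≤ Ebar a := by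
        intro a
        have hcw : ContinuousWithinAt (fun s => |e s a|) (Icc T₀ T₁) T := ((hec a).abs) T hTmem
        exact (hcw.eventually_lt_const (heT a)).mono fun _ h => h.le
      exact (Filter.eventually_all.2 hz').and (Filter.eventually_all.2 he') |>.mono
        fun t ht => ⟨ht.1, ht.2⟩
  refine ⟨fun s hs i => hrow s ⟨hs.1, hT.symm ▸ hs.2⟩ i, fun s hs a => ?_⟩
  exact (hPT s ⟨hs.1, hT.symm ▸ hs.2⟩).2 a

end ImplicitMajorant

end Summit.NavierStokesRegularity.FluidComputer
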